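import Summits.AtomisticToContinuum.HydrodynamicLimit.Theorems.JParityClosureEvenStressEnskogMeanEnskogRung0Helper
import Summits.AtomisticToContinuum.HydrodynamicLimit.Theorems.JParityClosureEvenStressEnskogTubeMeanRung0OfContact
import HarnessLib

/-!
# H6 `stub_meanEnskogRung0OfContact`: S3 at rung 0 modulo the canonical contact theorem (crux line `even-rung-mean-variance`,
# `JParityClosure.EvenStressEnskog`, stmt-AtomisticToContinuum-13079)

The registered helper stub H6 is the composition of the landed assembly `meanEnskogRung0_of_tubeMean` (S6 + H4 + flow invariance of
the rung-0 Gibbs law) with the landed tube-side mean H5 `stub_tubeMeanRung0OfContact`.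
-/

noncomputable section

open MeasureTheory Set Filter Topology
open scoped ENNReal InnerProductSpace BigOperators Pointwise

namespace Summit.AtomisticToContinuum.HydrodynamicLimit.Theorems.EvenStressEnskog

open Literature.Analysis.FluidPDE Literature.MathematicalPhysics.KineticTheory
open Summit.AtomisticToContinuum.HydrodynamicLimit.Theses.JParityClosure

/-- **H6 · S3 AT RUNG 0 MODULO THE CONTACT THEOREM** (registered helper stub `stub_meanEnskogRung0OfContact`): for constant profiles the
time-averaged Gibbs mean of the even tube functional is small, given the canonical contact theorem in phase-space form — from the tube-side
mean (H5) and the assembly `meanEnskogRung0_of_tubeMean`. -/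
theorem stub_meanEnskogRung0OfContact :
    (∃ σ₁ : ℝ, 0 < σ₁ ∧ ∀ σ : ℝ, 0 < σ → σ < σ₁ → ∀ ζ : ℝ, 0 < ζ → ∃ δ₁ : ℝ, 0 < δ₁ ∧ ∀ δ : ℝ, 0 < δ → δ ≤ δ₁ → ∃ N₀ : ℕ, ∀ N : ℕ, N₀ ≤ N → ∀ (a θ : ℝ) (u : V3), 0 < a → 0 < θ → ∀ Φ : HardSphereFlow (Torus.geometry (Fin 3)) (hsDiameter σ N) (N + 1), ∀ i j : Fin (N + 1), i ≠ j → ∀ S : Set V3, MeasurableSet S → S ⊆ {q | 1 < ‖q‖ ∧ ‖q‖ ≤ 1 + δ} → |(localGibbsLaw σ (fun _ => a) (fun _ => u) (fun _ => θ) N Φ).real {z | Torus.reprSym ((z i).1 - (z j).1) ∈ hsDiameter σ N • S} - contactValue (σ ^ 3) * hsDiameter σ N ^ 3 * (volume S).toReal| ≤ ζ * hsDiameter σ N ^ 3 * (volume S).toReal) → ∃ η₀ : ℝ, 0 < η₀ ∧ ∀ (a θ : ℝ) (u : V3), 0 < a → 0 < θ → ∃ σ₀ : ℝ, 0 < σ₀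 ∧ ∀ σ : ℝ, 0 < σ → σ < σ₀ → ∀ Φ : (N : ℕ) → HardSphereFlow (Torus.geometry (Fin 3)) (hsDiameter σ N) (N + 1), ∀ τ : ℝ, 0 < τ → ∀ χ : ℝ × UnitAddTorus (Fin 3) → ℝ, Continuous χ → ∀ g : ℝ → ℝ, Continuous g → (∀ b, η₀ ≤ b → g b = 0) → ∀ η : ℝ, 0 < η → ∃ r₀ : ℝ, 0 < r₀ ∧ ∀ r : ℝ, 0 < r → r < r₀ → ∀ L : ℝ, 1 ≤ L → ∃ κ₀ : ℝ, 0 < κ₀ ∧ ∀ κ : ℝ, 0 < κ → κ < κ₀ → ∃ N₀ : ℕ, ∀ N : ℕ, N₀ ≤ N → ∀ k l : Fin 3, |∫ t in Set.Icc (0 : ℝ) τ, ∫ z, evenTubeStat σ N χ g (evenMarkTrunc k l L) r κ t ((Φ N).flow t z) ∂(localGibbsLaw σ (fun _ => a) (fun _ => u) (fun _ => θ) N (Φ N))| ≤ η :=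
  fun hC => meanEnskogRung0_of_tubeMean stub_tubeMeanRung0OfContact hC

end Summit.AtomisticToContinuum.HydrodynamicLimit.Theorems.EvenStressEnskog

end
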